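import Literature.Analysis.FluidPDE.PlanarTypedChain
import Literature.Analysis.FluidPDE.PlanarTypedElements2
import HarnessLib

/-!
# Typed chains, second layer: phases whose nodes may be sheared diagonal graph bands

Topic `Literature/Analysis/FluidPDE`. `PlanarTypedChain.lean` packages runs and diagonal graph
bands (`ElemQ`) into nodes and phases (`NodeQ`, `PhaseQ`) and proves the element facts, the banded
well-formedness and the assembled move of a phase. This file does the same for the second-layer
elements `ElemQ2` (`PlanarTypedElements2.lean`: `base ElemQ | sdg SDgQ`) WITHOUT copying the
geometry: a second-layer phase `PhaseQ2` has a **geometric proxy** `PhaseQ2.geoPhase : PhaseQ`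
(every node's element replaced by its proxy `ElemQ2.geo`, same boxes / steps / annotations), its
moving chain, bands and all geometric checks of the sequel are READ ON THE PROXY, and only the
element scalars / stream functions (`Θ`, `H`) are those of the second-layer elements. Proved: the
element facts (`facts`; band containment through `ElemQ2.mem_bandT_geo_of_scalar_ne_zero` — the
band of a sheared element is the tight band of its proxy), and the assembled move of a valid,
well-formed phase (smooth, divergence free), exactly as in the first layer.

Folklore; no named facts. Infrastructure towards a discharge of `acm_compatible_blocks`
(`QuasiSelfSimilarCompatibleBlocks.lean`).

## References

* G. Alberti, G. Crippa, A. L. Mazzucato, *Exponential self-similar mixing by incompressible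
  flows*, J. Amer. Math. Soc. 32 (2019), 445–490, §7 (arXiv:1605.02090).
-/

noncomputable section

open Function Set Filter
open scoped Topology ContDiff

namespace Literature.Analysis.FluidPDE

namespace PlanarKinematics

open Gluing

/-- The plane `ℝ²` as a Euclidean space. [folklore] -/
local notation "E²" => EuclideanSpace ℝ (Fin 2)

/-! ## The band of a second-layer element is the tight band of its proxy -/

namespace ElemQ2

/-- **Tight band of a second-layer element**: that of its geometric proxy (for a sheared element the
loose band `|v - T(u)| ≤ r₀ · whi`). [folklore] -/
def bandT (e : ElemQ2) (t₀ τ r₀ : ℝ) : Set (ℝ × E²) := e.geo.bandT t₀ τ r₀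

/-- The tight band of the proxy of a sheared element is its loose band. [folklore] -/
theorem bandT_geo_sdg (s : SDgQ) (t₀ τ r₀ : ℝ) : (ElemQ.dg s.geoDg).bandT t₀ τ r₀ = s.band t₀ τ r₀ := by
  ext p
  simp only [ElemQ.bandT, SDgQ.geoDg_o, SDgQ.geoDg_T, SDgQ.geoDg_Ξ, SDgQ.geoXi_cdu, mem_setOf_eq, SDgQ.band,
    DgQ.band]

/-- **Tight band containment through the proxy**: if `G` vanishes off `(-r₀, r₀)`, the scalar of a
valid second-layer element is nonzero only on the tight band of its proxy. [folklore] -/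
theorem mem_bandT_geo_of_scalar_ne_zero (e : ElemQ2) {G : ℝ → ℝ} {t₀ τ r₀ : ℝ} (hG0 : ∀ q, G q ≠ 0 → |q| < r₀)
    (hv : e.validB = true) {p : ℝ × E²} (hne : e.scalar t₀ τ G p.1 p.2 ≠ 0) : p ∈ e.geo.bandT t₀ τ r₀ := by
  cases e with
  | base b => exact ElemQ.mem_bandT_of_scalar_ne_zero b hG0 hv hne
  | sdg s =>
    rw [geo_sdg, bandT_geo_sdg]
    exact SDgQ.mem_band_of_scalar_ne_zero hG0 hv hne

end ElemQ2

/-! ## Nodes and phases of the second layer -/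

/-- **Node of the second layer**: a second-layer element with its moving box, out-junction step and
annotation. [folklore] -/
structure NodeQ2 where
  /-- the element -/
  e : ElemQ2
  /-- its moving box -/
  box : BoxQ
  /-- its out-junction step (unused for the last element) -/
  step : StepQ
  /-- its annotation (certificates checked by the sequel; no semantics here) -/
  ann : AnnQ
deriving DecidableEq, Inhabited

namespace NodeQ2

/-- **Geometric proxy of a node**: the proxy element with the same box, step and annotation. [folklore] -/
def geo (n : NodeQ2) : NodeQ := ⟨n.e.geo, n.box, n.step, n.ann⟩

/-- A first-layer node as a second-layer node. [folklore] -/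
def ofNode (n : NodeQ) : NodeQ2 := ⟨.base n.e, n.box, n.step, n.ann⟩

/-- Unfolding / bookkeeping lemma. [folklore] -/
@[simp] theorem geo_e (n : NodeQ2) : n.geo.e = n.e.geo := rfl
/-- Unfolding / bookkeeping lemma. [folklore] -/
@[simp] theorem geo_box (n : NodeQ2) : n.geo.box = n.box := rfl
/-- Unfolding / bookkeeping lemma. [folklore] -/
@[simp] theorem geo_step (n : NodeQ2) : n.geo.step = n.step := rfl
/-- Unfolding / bookkeeping lemma. [folklore] -/
@[simp] theorem geo_ann (n : NodeQ2) : n.geo.ann = n.ann := rfl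
/-- Unfolding / bookkeeping lemma. [folklore] -/
@[simp] theorem geo_ofNode (n : NodeQ) : (ofNode n).geo = n := by cases n; rfl

/-- **Material view of a node**: the first-layer element of its data (a sheared band becomes the
diagonal band of its data), same box, step and annotation. [folklore] -/
def toNode (n : NodeQ2) : NodeQ := ⟨n.e.toElemQ, n.box, n.step, n.ann⟩

/-- Unfolding / bookkeeping lemma. [folklore] -/
@[simp] theorem toNode_e (n : NodeQ2) : n.toNode.e = n.e.toElemQ := rfl
/-- Unfolding / bookkeeping lemma. [folklore] -/
@[simp] theorem toNode_box (n : NodeQ2) : n.toNode.box = n.box := rfl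
/-- Unfolding / bookkeeping lemma. [folklore] -/
@[simp] theorem toNode_step (n : NodeQ2) : n.toNode.step = n.step := rfl
/-- Unfolding / bookkeeping lemma. [folklore] -/
@[simp] theorem toNode_ann (n : NodeQ2) : n.toNode.ann = n.ann := rfl


end NodeQ2

/-- **Phase of the second layer**: time slot, profile support radius, and the nodes. [folklore] -/
structure PhaseQ2 where
  /-- start of the clock transition window -/
  t₀ : ℚ
  /-- length of the clock window (`> 0`) -/
  τ : ℚ
  /-- support radius of the transverse profile -/
  r₀ : ℚ
  /-- the nodes -/
  nodes : List NodeQ2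
deriving DecidableEq, Inhabited

namespace PhaseQ2

variable (P : PhaseQ2)

/-- **Geometric proxy of a phase**: same clock, radius, boxes, steps, annotations; proxy elements.
[folklore] -/
def geoPhase : PhaseQ := ⟨P.t₀, P.τ, P.r₀, P.nodes.map NodeQ2.geo⟩

/-- A first-layer phase as a second-layer phase. [folklore] -/
def ofPhase (Q : PhaseQ) : PhaseQ2 := ⟨Q.t₀, Q.τ, Q.r₀, Q.nodes.map NodeQ2.ofNode⟩

/-- Number of elements. [folklore] -/
def K : ℕ := P.nodes.length

/-- Node `k` (default beyond the list). [folklore] -/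
def node (k : ℕ) : NodeQ2 := P.nodes.getD k default

/-- The clock parameters as reals. [folklore] -/
def T0 : ℝ := P.t₀

/-- The clock parameters as reals. [folklore] -/
def Tau : ℝ := P.τ

/-- **The moving chain of a phase** (that of the proxy). [folklore] -/
def chain : MovingChain := P.geoPhase.chain

/-- **The element scalars** (profile `G`). [folklore] -/
def Θ (G : ℝ → ℝ) : ℕ → ℝ → E² → ℝ := fun k => (P.node k).e.scalar P.T0 P.Tau G

/-- **The element stream functions.** [folklore] -/
def H : ℕ → ℝ → E² → ℝ := fun k => (P.node k).e.stream P.T0 P.Tau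

/-- **The element bands** (those of the proxy). [folklore] -/
def Band : ℕ → Set (ℝ × E²) := P.geoPhase.Band

/-- Unfolding / bookkeeping lemma. [folklore] -/
@[simp] theorem geoPhase_t₀ : P.geoPhase.t₀ = P.t₀ := rfl
/-- Unfolding / bookkeeping lemma. [folklore] -/
@[simp] theorem geoPhase_τ : P.geoPhase.τ = P.τ := rfl
/-- Unfolding / bookkeeping lemma. [folklore] -/
@[simp] theorem geoPhase_r₀ : P.geoPhase.r₀ = P.r₀ := rfl
/-- Unfolding / bookkeeping lemma. [folklore] -/
@[simp] theorem geoPhase_K : P.geoPhase.K = P.K := by simp [PhaseQ.K, K, geoPhase]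
/-- Unfolding / bookkeeping lemma. [folklore] -/
@[simp] theorem geoPhase_T0 : P.geoPhase.T0 = P.T0 := rfl
/-- Unfolding / bookkeeping lemma. [folklore] -/
@[simp] theorem geoPhase_Tau : P.geoPhase.Tau = P.Tau := rfl

/-- The nodes of the proxy are the proxies of the nodes. [folklore] -/
@[simp] theorem geoPhase_node (k : ℕ) : P.geoPhase.node k = (P.node k).geo := by
  simp only [PhaseQ.node, geoPhase, node]
  rw [List.getD_eq_getElem?_getD, List.getD_eq_getElem?_getD, List.getElem?_map]
  cases P.nodes[k]? <;> rfl

/-- Fields of the chain. [folklore] -/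
@[simp] theorem chain_K (P : PhaseQ2) : P.chain.K = P.K := by simp [chain]

/-- A node of index `< K` is a member of the node list. [folklore] -/
theorem node_mem (P : PhaseQ2) {k : ℕ} (hk : k < P.K) : P.node k ∈ P.nodes := by
  have hk' : k < P.nodes.length := hk
  rw [node, List.getD_eq_getElem?_getD, List.getElem?_eq_getElem hk', Option.getD_some]
  exact List.getElem_mem hk'

/-- The round trip of a first-layer phase through the second layer is the identity on the proxy.
[folklore] -/
theorem geoPhase_ofPhase (Q : PhaseQ) : (ofPhase Q).geoPhase = Q := by
  cases Q with
  | mk t₀ τ r₀ nodes =>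
    simp only [ofPhase, geoPhase, List.map_map]
    congr 1
    conv_rhs => rw [← List.map_id nodes]
    refine List.map_congr_left fun n _ => ?_
    simp [Function.comp, NodeQ2.geo_ofNode]

/-- **Material view of a phase**: the first-layer phase of the node data (every MATERIAL test —
junction agreement, re-description — is read here; the GEOMETRIC tests on `geoPhase`). [folklore] -/
def toPhase : PhaseQ := ⟨P.t₀, P.τ, P.r₀, P.nodes.map NodeQ2.toNode⟩

/-- Unfolding / bookkeeping lemma. [folklore] -/
@[simp] theorem toPhase_K : P.toPhase.K = P.K := by simp [PhaseQ.K, K, toPhase]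
/-- Unfolding / bookkeeping lemma. [folklore] -/
@[simp] theorem toPhase_T0 : P.toPhase.T0 = P.T0 := rfl
/-- Unfolding / bookkeeping lemma. [folklore] -/
@[simp] theorem toPhase_Tau : P.toPhase.Tau = P.Tau := rfl
/-- Unfolding / bookkeeping lemma. [folklore] -/
@[simp] theorem toPhase_r₀ : P.toPhase.r₀ = P.r₀ := rfl

/-- The nodes of the material view. [folklore] -/
@[simp] theorem toPhase_node (k : ℕ) : P.toPhase.node k = (P.node k).toNode := by
  simp only [PhaseQ.node, toPhase, node]
  rw [List.getD_eq_getElem?_getD, List.getD_eq_getElem?_getD, List.getElem?_map]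
  cases P.nodes[k]? <;> rfl

/-- The element scalar of the material view. [folklore] -/
theorem toPhase_Θ (G : ℝ → ℝ) (k : ℕ) : P.toPhase.Θ G k = (P.node k).e.toElemQ.scalar P.T0 P.Tau G := by
  simp [PhaseQ.Θ]

/-- The element stream function of the material view. [folklore] -/
theorem toPhase_H (k : ℕ) : P.toPhase.H k = (P.node k).e.toElemQ.stream P.T0 P.Tau := by
  simp [PhaseQ.H]



/-! ### Element facts from validity -/

/-- **Validity test of the elements and the clock**: every element valid, `τ > 0`. [folklore] -/
def elemsValidB : Bool := (P.nodes.all fun n => n.e.validB) && decide (0 < P.τ)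

variable {P}

/-- A valid phase has a positive clock window. [folklore] -/
theorem Tau_pos {P : PhaseQ2} (hv : P.elemsValidB = true) : 0 < P.Tau := by
  simp only [elemsValidB, Bool.and_eq_true, decide_eq_true_eq] at hv
  show (0 : ℝ) < (P.τ : ℝ)
  exact_mod_cast hv.2

/-- A valid phase has a nonzero clock window. [folklore] -/
theorem Tau_ne_zero {P : PhaseQ2} (hv : P.elemsValidB = true) : P.Tau ≠ 0 := (Tau_pos hv).ne'

/-- Every element of a valid phase is valid. [folklore] -/
theorem validB_node {P : PhaseQ2} (hv : P.elemsValidB = true) {k : ℕ} (hk : k < P.K) : (P.node k).e.validB = true := by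
  simp only [elemsValidB, Bool.and_eq_true, List.all_eq_true] at hv
  exact hv.1 _ (P.node_mem hk)

/-- Validity passes to the material view. [folklore] -/
theorem elemsValidB_toPhase (hv : P.elemsValidB = true) : P.toPhase.elemsValidB = true := by
  simp only [elemsValidB, Bool.and_eq_true, List.all_eq_true, decide_eq_true_eq] at hv
  simp only [PhaseQ.elemsValidB, toPhase, Bool.and_eq_true, List.all_eq_true, List.mem_map, decide_eq_true_eq,
    forall_exists_index, and_imp]
  refine ⟨fun n m hm hnm => ?_, hv.2⟩
  rw [← hnm, NodeQ2.toNode_e]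
  exact ElemQ2.validB_toElemQ (hv.1 m hm)


/-- **Validity passes to the proxy phase.** [folklore] -/
theorem elemsValidB_geoPhase (hv : P.elemsValidB = true) : P.geoPhase.elemsValidB = true := by
  simp only [elemsValidB, Bool.and_eq_true, List.all_eq_true, decide_eq_true_eq] at hv
  simp only [PhaseQ.elemsValidB, geoPhase, Bool.and_eq_true, List.all_eq_true, List.mem_map, decide_eq_true_eq,
    forall_exists_index, and_imp]
  refine ⟨fun n m hm hnm => ?_, hv.2⟩
  rw [← hnm, NodeQ2.geo_e]
  exact ElemQ2.validB_geo (hv.1 m hm)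

/-- **Element facts of a valid phase**: smooth fields, transport of every `Θ_k` by `∇⊥H_k`
everywhere, the bound, and band containment IN THE BANDS OF THE PROXY. [folklore] -/
theorem facts {P : PhaseQ2} {G : ℝ → ℝ} {M : ℝ} (hG : ContDiff ℝ ∞ G) (hM : ∀ q, |G q| ≤ M) (hM0 : 0 ≤ M)
    (hG0 : ∀ q, G q ≠ 0 → |q| < P.r₀) (hv : P.elemsValidB = true) : P.chain.Facts (P.Θ G) P.H M P.Band where
  smooth_scalar _ hk := ElemQ2.contDiff_uncurry_scalar hG (validB_node hv (by simpa using hk))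
  smooth_stream _ hk := ElemQ2.contDiff_uncurry_stream (Tau_ne_zero hv) (validB_node hv (by simpa using hk))
  transport _ hk t z := ElemQ2.transport hG (Tau_ne_zero hv) (validB_node hv (by simpa using hk)) t z
  abs_le _ _ t z := ElemQ2.abs_scalar_le hM t z
  M_nonneg := hM0
  band k hk p hne := by
    have hk' : k < P.K := by simpa using hk
    show p ∈ (P.geoPhase.node k).e.bandT P.geoPhase.T0 P.geoPhase.Tau P.geoPhase.r₀
    rw [geoPhase_node, NodeQ2.geo_e]
    exact ElemQ2.mem_bandT_geo_of_scalar_ne_zero _ hG0 (validB_node hv hk') hne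

/-! ### The move of a phase -/

variable (P)

/-- **The assembled scalar of a phase** (profile `G`). [folklore] -/
def scalar (P : PhaseQ2) (G : ℝ → ℝ) : ℝ → E² → ℝ := assembledScalar P.chain.K P.chain.chi (P.Θ G)

/-- **The assembled stream function of a phase** (reference stream `0`). [folklore] -/
def stream (P : PhaseQ2) : ℝ → E² → ℝ := assembledStream P.chain.K 0 P.chain.chi P.H

/-- **The assembled velocity of a phase.** [folklore] -/
def velocity (P : PhaseQ2) : ℝ → E² → E² := assembledVelocity P.chain.K 0 P.chain.chi P.H

variable {P}

/-- The assembled scalar of a valid, well-formed phase is smooth. [folklore] -/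
theorem contDiff_uncurry_scalar {P : PhaseQ2} {G : ℝ → ℝ} {M : ℝ} (hG : ContDiff ℝ ∞ G) (hM : ∀ q, |G q| ≤ M) (hM0 : 0 ≤ M)
    (hG0 : ∀ q, G q ≠ 0 → |q| < P.r₀) (hv : P.elemsValidB = true) (hw : P.chain.WFBd P.Band) :
    ContDiff ℝ ∞ (uncurry (P.scalar G)) := by
  have h := hw.contDiff_uncurry_scalar (facts hG hM hM0 hG0 hv)
  simpa [scalar] using h

/-- The assembled velocity of a valid, well-formed phase is smooth. [folklore] -/
theorem contDiff_uncurry_velocity {P : PhaseQ2} {G : ℝ → ℝ} {M : ℝ} (hG : ContDiff ℝ ∞ G) (hM : ∀ q, |G q| ≤ M) (hM0 : 0 ≤ M)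
    (hG0 : ∀ q, G q ≠ 0 → |q| < P.r₀) (hv : P.elemsValidB = true) (hw : P.chain.WFBd P.Band) :
    ContDiff ℝ ∞ (uncurry P.velocity) := by
  have h := hw.contDiff_uncurry_velocity (H₀ := 0) (facts hG hM hM0 hG0 hv)
  simpa [velocity] using h

/-- The assembled velocity of a valid, well-formed phase is divergence free everywhere. [folklore] -/
theorem divergence_velocity {P : PhaseQ2} {G : ℝ → ℝ} {M : ℝ} (hG : ContDiff ℝ ∞ G) (hM : ∀ q, |G q| ≤ M) (hM0 : 0 ≤ M)
    (hG0 : ∀ q, G q ≠ 0 → |q| < P.r₀) (hv : P.elemsValidB = true) (hw : P.chain.WFBd P.Band) (t : ℝ) (z : E²) :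
    ∑ j, fderiv ℝ (P.velocity t) z (EuclideanSpace.single j 1) j = 0 := by
  have h := hw.divergence_velocity (H₀ := 0) (facts hG hM hM0 hG0 hv) t z
  simpa [velocity] using h

end PhaseQ2

end PlanarKinematics

end Literature.Analysis.FluidPDE
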